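import Mathlib
import Literature.MathematicalPhysics.QuantumLattice.WilsonDiracAP

/-!
# The cell Wilson form is coercive modulo gauge on the `2⁴` block
(helper for crux stmt-QuantumFields-9734, line `Sketch`, stub `stub_gaugeCoercive`)

What.  On the `2⁴` block (sites `TorusSite 4 2 = Fin 4 → ZMod 2`, `64` links) let
`Y : Edge 4 2 → M₃(ℂ)` be linkwise anti-Hermitian and TILING-ODD,
`Y (x + μ̂, μ) = -Y (x, μ)`.  The cell Wilson form is
`𝒦(Y) = Σ_{x, i<j} ‖Y(x,i) + Y(x+î,j) - Y(x+ĵ,i) - Y(x,j)‖_F²`.  We prove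
(`stub_gaugeCoercive`): there is an anti-Hermitian site function `λ` with
`8 · Σ_e ‖Y e - (λ(e.1) - λ(e.1 + ê.2))‖_F² ≤ 𝒦(Y)`.

How.  Walsh–Fourier analysis on `(ℤ/2)⁴` with the sixteen REAL characters
`χ_s(x) = Π_μ sgn(s_μ x_μ)`, `sgn 0 = 1`, `sgn 1 = -1` (namespace `GaugeCoercive`):
orthogonality `Σ_s χ_s(x) χ_s(y) = 16·[x = y]`, Plancherel `Σ_s ĥ(s)² = 16 Σ_x h(x)²`, and
the shift rule `Σ_x χ_s(x) h(x + μ̂) = sgn(s_μ) ĥ(s)`.  For a tiling-odd REAL link field `g` the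
Walsh components `v_μ(s) = Σ_x χ_s(x) g(x,μ)` vanish unless `s_μ = 1`; the transform of the
plaquette combination is `2([s_j = 1] v_i - [s_i = 1] v_j)`, and with the gauge generator
`L(x) = Σ_s χ_s(x) (Σ_μ v_μ(s)) / (32 n_s)`, `n_s = #{μ : s_μ = 1}`, the transform of
`g - dL` in direction `μ` is `v_μ(s) - [s_μ = 1]·mean_s`.  The inequality is thereby reduced to
sixteen elementary inequalities for `4`-vectors (`per_class`, one for each sign class `s`,
checked by `nlinarith`): `½ Σ_{μ active} (v_μ - mean)² ≤ ¼ Σ_{i<j active} (v_i - v_j)²`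
(equality for `n_s ≤ 2`).  The complex matrix statement follows entrywise from the real one
applied to the real and imaginary parts of each colour entry (`sum_frob_le_of_re_im`); the
generator `λ(x) = Σ_s (χ_s(x)/(32 n_s)) Σ_μ Σ_y χ_s(y) Y(y,μ)` has real coefficients, hence
is anti-Hermitian with `Y`.
Sources: folklore (discrete Hodge/Walsh decomposition on the hypercube).  Pure theorem file; the
characters `χ`, the components `v` and the generator are variables with defining hypotheses,
instantiated by `rfl`.
-/

noncomputable section

open scoped BigOperators Classical Matrix ComplexConjugate
open Finset
open Literature.MathematicalPhysics.QuantumLattice Literature.MathematicalPhysics.QuantumFieldTheory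
  Literature.Probability.LatticeModels

namespace Summit.QuantumFields.QCD.Cruxes.CriticalLineDiamagnetism.ChessboardCellGain

namespace GaugeCoercive

/-! ### Signs on `ℤ/2` -/

/-- `sgn a · sgn a = 1` for the sign `sgn a = (-1)^a` on `ℤ/2`. -/
theorem sgn_mul_self (a : ZMod 2) :
    (if a = 0 then (1 : ℝ) else -1) * (if a = 0 then 1 else -1) = 1 := by
  split_ifs <;> norm_num

/-- `sgn a · sgn b = -1` for `a ≠ b` in `ℤ/2`. -/
theorem sgn_mul_sgn_of_ne {a b : ZMod 2} (h : a ≠ b) :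
    (if a = 0 then (1 : ℝ) else -1) * (if b = 0 then 1 else -1) = -1 := by
  have z2 : ∀ c : ZMod 2, c = 0 ∨ c = 1 := by decide
  rcases z2 a with rfl | rfl <;> rcases z2 b with rfl | rfl <;> simp_all

/-! ### Walsh characters on `(ℤ/2)⁴` -/

variable (χ : TorusSite 4 2 → TorusSite 4 2 → ℝ)
  (hχ : ∀ s x, χ s x = ∏ μ, if s μ * x μ = 0 then (1 : ℝ) else -1)
include hχ

/-- The Walsh pairing is symmetric. -/
theorem chi_symm (s x : TorusSite 4 2) : χ s x = χ x s := by
  simp only [hχ, mul_comm]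

/-- `χ_s(x)² = 1`. -/
theorem chi_mul_self (s x : TorusSite 4 2) : χ s x * χ s x = 1 := by
  rw [hχ, ← Finset.prod_mul_distrib]
  exact Finset.prod_eq_one fun μ _ => sgn_mul_self _

/-- Shift rule: `χ_s(x + μ̂) = sgn(s_μ) χ_s(x)`. -/
theorem chi_shift (s x : TorusSite 4 2) (μ : Fin 4) :
    χ s (Site.shift x μ) = (if s μ = 0 then 1 else -1) * χ s x := by
  rw [hχ, hχ, ← Finset.mul_prod_erase _ _ (Finset.mem_univ μ),
    ← Finset.mul_prod_erase Finset.univ (fun ν => if s ν * x ν = 0 then (1 : ℝ) else -1)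
      (Finset.mem_univ μ), ← mul_assoc]
  congr 1
  · -- the sign is a character of `(ℤ/2, +)`
    have sgn_add : ∀ a b : ZMod 2, (if a + b = 0 then (1 : ℝ) else -1) =
        (if a = 0 then (1 : ℝ) else -1) * (if b = 0 then 1 else -1) := by
      have z2 : ∀ c : ZMod 2, c = 0 ∨ c = 1 := by decide
      have h11 : (1 : ZMod 2) + 1 = 0 := by decide
      intro a b
      rcases z2 a with rfl | rfl <;> rcases z2 b with rfl | rfl <;> simp [h11]
    rw [show Site.shift x μ μ = x μ + 1 by
      simp [Literature.MathematicalPhysics.QuantumFieldTheory.Site.shift], mul_add, mul_one,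
      sgn_add, mul_comm]
  · refine Finset.prod_congr rfl fun ν hν => ?_
    rw [show Site.shift x μ ν = x ν by
      simp [Literature.MathematicalPhysics.QuantumFieldTheory.Site.shift,
        Pi.single_eq_of_ne (Finset.ne_of_mem_erase hν)]]

/-- Shift rule in the first argument: `χ_{s + μ̂}(x) = sgn(x_μ) χ_s(x)`. -/
theorem chi_shift_left (s x : TorusSite 4 2) (μ : Fin 4) :
    χ (Site.shift s μ) x = (if x μ = 0 then 1 else -1) * χ s x := by
  rw [chi_symm χ hχ (Site.shift s μ) x, chi_shift χ hχ x s μ, chi_symm χ hχ x s]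

/-- Orthogonality of the Walsh characters: `Σ_s χ_s(x) χ_s(y) = 16·[x = y]`. -/
theorem sum_chi_mul (x y : TorusSite 4 2) : ∑ s, χ s x * χ s y = if x = y then 16 else 0 := by
  split_ifs with h
  · subst h
    have hcard : Fintype.card (TorusSite 4 2) = 16 := by
      rw [Fintype.card_fun, ZMod.card, Fintype.card_fin]
      norm_num
    simp only [chi_mul_self χ hχ, Finset.sum_const, Finset.card_univ, hcard]
    norm_num
  · obtain ⟨μ, hμ⟩ := Function.ne_iff.1 h
    have hneg : ∑ s, χ s x * χ s y = ∑ s, (-1) * (χ s x * χ s y) := by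
      refine Fintype.sum_equiv (Equiv.addRight (Pi.single μ (1 : ZMod 2))) _ _ fun s => ?_
      show χ s x * χ s y = -1 * (χ (Site.shift s μ) x * χ (Site.shift s μ) y)
      rw [chi_shift_left χ hχ, chi_shift_left χ hχ]
      linear_combination (χ s x * χ s y) * sgn_mul_sgn_of_ne hμ
    rw [← Finset.mul_sum] at hneg
    linarith

/-- Orthogonality in the other variable: `Σ_x χ_s(x) χ_t(x) = 16·[s = t]`. -/
theorem sum_chi_mul_right (s t : TorusSite 4 2) :
    ∑ x, χ s x * χ t x = if s = t then 16 else 0 := by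
  rw [← sum_chi_mul χ hχ s t]
  exact Finset.sum_congr rfl fun x _ => by rw [chi_symm χ hχ s x, chi_symm χ hχ t x]

/-- Plancherel for the Walsh transform: `Σ_x h(x)² = (1/16) Σ_s (Σ_x χ_s(x) h(x))²`. -/
theorem plancherel (h : TorusSite 4 2 → ℝ) :
    ∑ x, h x ^ 2 = 1 / 16 * ∑ s, (∑ x, χ s x * h x) ^ 2 := by
  have key : ∑ s, (∑ x, χ s x * h x) ^ 2 = 16 * ∑ x, h x ^ 2 := by
    calc ∑ s, (∑ x, χ s x * h x) ^ 2 = ∑ s, ∑ x, ∑ y, h x * h y * (χ s x * χ s y) := by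
          refine Finset.sum_congr rfl fun s _ => ?_
          rw [sq, Finset.sum_mul_sum]
          exact Finset.sum_congr rfl fun x _ => Finset.sum_congr rfl fun y _ => by ring
      _ = ∑ x, ∑ y, h x * h y * ∑ s, χ s x * χ s y := by
          rw [Finset.sum_comm]
          refine Finset.sum_congr rfl fun x _ => ?_
          rw [Finset.sum_comm]
          exact Finset.sum_congr rfl fun y _ => by rw [Finset.mul_sum]
      _ = 16 * ∑ x, h x ^ 2 := by
          simp only [sum_chi_mul χ hχ, mul_ite, mul_zero, Finset.sum_ite_eq, Finset.mem_univ,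
            if_true]
          rw [Finset.mul_sum]
          exact Finset.sum_congr rfl fun x _ => by ring
  rw [key]
  ring

/-- Shift rule for the Walsh transform: `Σ_x χ_s(x) h(x + μ̂) = sgn(s_μ) Σ_x χ_s(x) h(x)`. -/
theorem transform_shift (h : TorusSite 4 2 → ℝ) (s : TorusSite 4 2) (μ : Fin 4) :
    ∑ x, χ s x * h (Site.shift x μ) = (if s μ = 0 then 1 else -1) * ∑ x, χ s x * h x := by
  rw [Finset.mul_sum]
  refine Fintype.sum_equiv (Equiv.addRight (Pi.single μ (1 : ZMod 2))) _ _ fun x => ?_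
  show χ s x * h (Site.shift x μ) =
    (if s μ = 0 then (1 : ℝ) else -1) * (χ s (Site.shift x μ) * h (Site.shift x μ))
  rw [chi_shift χ hχ, ← mul_assoc, ← mul_assoc, sgn_mul_self, one_mul]

omit hχ in
/-- The sum over ordered pairs `i < j` in `Fin 4`, written out. -/
theorem sum_pairs (F : Fin 4 × Fin 4 → ℝ) :
    ∑ q : {p : Fin 4 × Fin 4 // p.1 < p.2}, F q.1 =
      F (0, 1) + F (0, 2) + F (0, 3) + F (1, 2) + F (1, 3) + F (2, 3) := by
  rw [← Finset.sum_subtype (Finset.univ.filter fun p : Fin 4 × Fin 4 => p.1 < p.2) (by simp) F,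
    Finset.sum_filter, Fintype.sum_prod_type]
  simp [Fin.sum_univ_four]
  ring

omit hχ in
/-- The elementary inequality behind the coercivity, one Walsh class `s` at a time: for a
`4`-vector `v` supported on the active set `{μ : s_μ = 1}` (of size `n`) and
`C = (Σ v) / (32 n)`:
`½ Σ_μ (v_μ - 32·[s_μ = 1]·C)² ≤ (1/16) Σ_{i<j} (2[s_j = 1] v_i - 2[s_i = 1] v_j)²`,
that is,
`½ Σ_{active} (v - mean)² ≤ ¼ Σ_{i<j active} (v_i - v_j)² = (n/4) Σ_{active} (v - mean)²`
(sixteen sign patterns, each closed by `nlinarith`). -/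
theorem per_class (s : TorusSite 4 2) (v : Fin 4 → ℝ) (C : ℝ)
    (hv : ∀ μ, v μ = (if s μ = 0 then 0 else 1) * v μ)
    (hC : C = (∑ μ, v μ) / (32 * ∑ μ, if s μ = 0 then (0 : ℝ) else 1)) :
    8 * ∑ μ, 1 / 16 * (v μ - 32 * (if s μ = 0 then 0 else 1) * C) ^ 2 ≤
      ∑ q : {p : Fin 4 × Fin 4 // p.1 < p.2}, 1 / 16 *
        (2 * (if s q.1.2 = 0 then 0 else 1) * v q.1.1 -
          2 * (if s q.1.1 = 0 then 0 else 1) * v q.1.2) ^ 2 := by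
  subst hC
  rw [sum_pairs (fun p : Fin 4 × Fin 4 => 1 / 16 *
    (2 * (if s p.2 = 0 then 0 else 1) * v p.1 - 2 * (if s p.1 = 0 then 0 else 1) * v p.2) ^ 2)]
  simp only [Fin.sum_univ_four]
  rw [hv 0, hv 1, hv 2, hv 3]
  have z2 : ∀ c : ZMod 2, c = 0 ∨ c = 1 := by decide
  rcases z2 (s 0) with h0 | h0 <;> rcases z2 (s 1) with h1 | h1 <;>
    rcases z2 (s 2) with h2 | h2 <;> rcases z2 (s 3) with h3 | h3 <;>
    simp [h0, h1, h2, h3] <;>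
    nlinarith [sq_nonneg (v 0 - v 1), sq_nonneg (v 0 - v 2), sq_nonneg (v 0 - v 3),
      sq_nonneg (v 1 - v 2), sq_nonneg (v 1 - v 3), sq_nonneg (v 2 - v 3)]

/-- **The real scalar core.**  For a tiling-odd real link field `g` on the `2⁴` block and the
gauge generator `L(x) = Σ_s (χ_s(x) / (32 n_s)) Σ_μ Σ_y χ_s(y) g(y,μ)`:
`8 Σ_e (g e - (L(e.1) - L(e.1 + ê.2)))² ≤ Σ_{x, i<j} (g(x,i) + g(x+î,j) - g(x+ĵ,i) - g(x,j))²`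
(proof: Plancherel direction by direction (resp. plaquette orientation by orientation), the shift
rule, Fourier inversion for `L`, and `per_class` for every Walsh class). -/
theorem core (g : Edge 4 2 → ℝ)
    (hg : ∀ (x : TorusSite 4 2) (μ : Fin 4), g (Site.shift x μ, μ) = -g (x, μ))
    (L : TorusSite 4 2 → ℝ)
    (hL : ∀ x, L x = ∑ s, χ s x / (32 * ∑ ν, if s ν = 0 then (0 : ℝ) else 1) *
      ∑ μ : Fin 4, ∑ y, χ s y * g (y, μ)) :
    8 * ∑ e : Edge 4 2, (g e - (L e.1 - L (Site.shift e.1 e.2))) ^ 2 ≤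
      ∑ p : Plaquette 4 2, (g (p.1, p.2.1.1) + g (Site.shift p.1 p.2.1.1, p.2.1.2) -
        g (Site.shift p.1 p.2.1.2, p.2.1.1) - g (p.1, p.2.1.2)) ^ 2 := by
  -- Walsh components of `g`, direction by direction, and the Walsh coefficients of `L`
  obtain ⟨v, hv⟩ : ∃ v : Fin 4 → TorusSite 4 2 → ℝ,
      ∀ μ s, v μ s = ∑ x, χ s x * g (x, μ) := ⟨_, fun _ _ => rfl⟩
  obtain ⟨c, hc⟩ : ∃ c : TorusSite 4 2 → ℝ,
      ∀ s, c s = (∑ μ, v μ s) / (32 * ∑ ν, if s ν = 0 then (0 : ℝ) else 1) :=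
    ⟨_, fun _ => rfl⟩
  -- shifted transforms
  have hgshift : ∀ s μ ν,
      ∑ x, χ s x * g (Site.shift x μ, ν) = (if s μ = 0 then 1 else -1) * v ν s := by
    intro s μ ν
    rw [hv]
    exact transform_shift χ hχ (fun x => g (x, ν)) s μ
  -- (ii) inactive components vanish (tiling-oddness)
  have hv0 : ∀ μ s, v μ s = (if s μ = 0 then 0 else 1) * v μ s := by
    intro μ s
    split_ifs with h
    · have h1 : ∑ x, χ s x * g (Site.shift x μ, μ) = v μ s := by
        rw [hgshift, if_pos h, one_mul]
      have h2 : ∑ x, χ s x * g (Site.shift x μ, μ) = -v μ s := by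
        simp only [hg, mul_neg, Finset.sum_neg_distrib, hv]
      linarith
    · rw [one_mul]
  -- `L` in Walsh form, and its transform (Fourier inversion)
  have hL' : ∀ x, L x = ∑ s, χ s x * c s := fun x => by
    rw [hL]
    refine Finset.sum_congr rfl fun s _ => ?_
    rw [hc, div_mul_eq_mul_div, mul_div_assoc]
    simp only [hv]
  have hLhat : ∀ s, ∑ x, χ s x * L x = 16 * c s := fun s => by
    simp only [hL', Finset.mul_sum]
    rw [Finset.sum_comm]
    have h1 : ∀ t, ∑ x, χ s x * (χ t x * c t) = (if s = t then 16 else 0) * c t := fun t => by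
      rw [← sum_chi_mul_right χ hχ s t, Finset.sum_mul]
      exact Finset.sum_congr rfl fun x _ => by ring
    simp only [h1, ite_mul, zero_mul, Finset.sum_ite_eq, Finset.mem_univ, if_true]
  have hLshift : ∀ s μ,
      ∑ x, χ s x * L (Site.shift x μ) = (if s μ = 0 then 1 else -1) * (16 * c s) :=
    fun s μ => by rw [transform_shift χ hχ L s μ, hLhat]
  -- the left-hand side in Walsh variables
  have lhs : ∑ e : Edge 4 2, (g e - (L e.1 - L (Site.shift e.1 e.2))) ^ 2 =
      ∑ s, ∑ μ, 1 / 16 * (v μ s - 32 * (if s μ = 0 then 0 else 1) * c s) ^ 2 := by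
    calc _ = ∑ μ : Fin 4, ∑ x : TorusSite 4 2,
          (g (x, μ) - (L x - L (Site.shift x μ))) ^ 2 := by
          rw [Fintype.sum_prod_type]
          exact Finset.sum_comm
      _ = ∑ μ : Fin 4, 1 / 16 *
          ∑ s, (v μ s - 32 * (if s μ = 0 then 0 else 1) * c s) ^ 2 := by
          refine Finset.sum_congr rfl fun μ _ => ?_
          rw [plancherel χ hχ]
          congr 1
          refine Finset.sum_congr rfl fun s _ => ?_
          congr 1
          simp only [mul_sub, Finset.sum_sub_distrib, ← hv, hLshift, hLhat]
          split_ifs <;> ring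
      _ = _ := by
          simp only [Finset.mul_sum]
          exact Finset.sum_comm
  -- the right-hand side in Walsh variables
  have rhs : ∑ p : Plaquette 4 2, (g (p.1, p.2.1.1) + g (Site.shift p.1 p.2.1.1, p.2.1.2) -
        g (Site.shift p.1 p.2.1.2, p.2.1.1) - g (p.1, p.2.1.2)) ^ 2 =
      ∑ s, ∑ q : {p : Fin 4 × Fin 4 // p.1 < p.2}, 1 / 16 *
        (2 * (if s q.1.2 = 0 then 0 else 1) * v q.1.1 s -
          2 * (if s q.1.1 = 0 then 0 else 1) * v q.1.2 s) ^ 2 := by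
    calc _ = ∑ q : {p : Fin 4 × Fin 4 // p.1 < p.2}, ∑ x : TorusSite 4 2,
          (g (x, q.1.1) + g (Site.shift x q.1.1, q.1.2) - g (Site.shift x q.1.2, q.1.1) -
            g (x, q.1.2)) ^ 2 := by
          rw [Fintype.sum_prod_type]
          exact Finset.sum_comm
      _ = ∑ q : {p : Fin 4 × Fin 4 // p.1 < p.2}, 1 / 16 * ∑ s,
          (2 * (if s q.1.2 = 0 then 0 else 1) * v q.1.1 s -
            2 * (if s q.1.1 = 0 then 0 else 1) * v q.1.2 s) ^ 2 := by
          refine Finset.sum_congr rfl fun q _ => ?_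
          rw [plancherel χ hχ]
          congr 1
          refine Finset.sum_congr rfl fun s _ => ?_
          congr 1
          simp only [mul_add, mul_sub, Finset.sum_add_distrib, Finset.sum_sub_distrib, ← hv,
            hgshift]
          split_ifs <;> ring
      _ = _ := by
          simp only [Finset.mul_sum]
          exact Finset.sum_comm
  rw [lhs, rhs, Finset.mul_sum]
  exact Finset.sum_le_sum fun s _ =>
    per_class s (fun μ => v μ s) (c s) (fun μ => hv0 μ s) (hc s)

omit hχ in
/-- The Frobenius sum of squares of a family of `3 × 3` complex matrices, split entrywise into real
and imaginary parts. -/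
theorem sum_frob_eq_re_im {ι : Type*} [Fintype ι] (P : ι → Matrix (Fin 3) (Fin 3) ℂ) :
    ∑ i, ∑ a, ∑ b, ‖P i a b‖ ^ 2 =
      ∑ a, ∑ b, (∑ i, (P i a b).re ^ 2 + ∑ i, (P i a b).im ^ 2) := by
  calc _ = ∑ a, ∑ i, ∑ b, ‖P i a b‖ ^ 2 := Finset.sum_comm
    _ = _ := by
        refine Finset.sum_congr rfl fun a _ => ?_
        calc _ = ∑ b, ∑ i, ‖P i a b‖ ^ 2 := Finset.sum_comm
          _ = _ := by
              refine Finset.sum_congr rfl fun b _ => ?_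
              rw [← Finset.sum_add_distrib]
              refine Finset.sum_congr rfl fun i _ => ?_
              rw [Complex.sq_norm, Complex.normSq_apply]
              ring

omit hχ in
/-- Entrywise reduction: a Frobenius-norm inequality between two families of `3 × 3` complex
matrices follows from the corresponding inequalities for the real and imaginary parts of each
entry. -/
theorem sum_frob_le_of_re_im {ι κ : Type*} [Fintype ι] [Fintype κ]
    (M : ι → Matrix (Fin 3) (Fin 3) ℂ) (N : κ → Matrix (Fin 3) (Fin 3) ℂ)
    (hre : ∀ a b, 8 * ∑ i, (M i a b).re ^ 2 ≤ ∑ k, (N k a b).re ^ 2)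
    (him : ∀ a b, 8 * ∑ i, (M i a b).im ^ 2 ≤ ∑ k, (N k a b).im ^ 2) :
    8 * ∑ i, ∑ a, ∑ b, ‖M i a b‖ ^ 2 ≤ ∑ k, ∑ a, ∑ b, ‖N k a b‖ ^ 2 := by
  rw [sum_frob_eq_re_im M, sum_frob_eq_re_im N, Finset.mul_sum]
  refine Finset.sum_le_sum fun a _ => ?_
  rw [Finset.mul_sum]
  refine Finset.sum_le_sum fun b _ => ?_
  rw [mul_add]
  exact add_le_add (hre a b) (him a b)

end GaugeCoercive

/-- **Stub MgK — `gaugeCoercive` (the cell Wilson form is coercive modulo gauge; finite Fourier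
analysis on `(ℤ/2)⁴`).**  For a tiling-odd anti-Hermitian block link field `Y` there is an
anti-Hermitian gauge generator `λ` with `8·‖Y − dλ‖² ≤ 𝒦(Y) = Σ_p ‖curl Y_p‖²_F`.  The generator
is `λ(x) = Σ_s (χ_s(x) / (32 n_s)) Σ_μ Σ_y χ_s(y) Y(y,μ)` (real Walsh characters `χ_s`, `n_s` the
number of active directions of the class `s`); the inequality is `GaugeCoercive.core` applied to
the real and imaginary parts of every colour entry (`GaugeCoercive.sum_frob_le_of_re_im`). -/
theorem stub_gaugeCoercive : ∀ Y : Edge 4 2 → Matrix (Fin 3) (Fin 3) ℂ, (∀ e, (Y e)ᴴ = -Y e) → (∀ (x : TorusSite 4 2) (μ : Fin 4), Y (Site.shift x μ, μ) = -Y (x, μ)) → ∃ lam : TorusSite 4 2 → Matrix (Fin 3) (Fin 3) ℂ, (∀ x, (lam x)ᴴ = -lam x) ∧ 8 * (∑ e : Edge 4 2, ∑ a, ∑ b, ‖(Y e - (lam e.1 - lam (Site.shift e.1 e.2))) a b‖ ^ 2) ≤ (∑ p : Plaquette 4 2, ∑ a, ∑ b, ‖(Y (p.1, p.2.1.1) +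 Y (Site.shift p.1 p.2.1.1, p.2.1.2) - Y (Site.shift p.1 p.2.1.2, p.2.1.1) - Y (p.1, p.2.1.2)) a b‖ ^ 2) := by
  intro Y hY hodd
  obtain ⟨χ, hχ⟩ : ∃ χ : TorusSite 4 2 → TorusSite 4 2 → ℝ,
      ∀ s x, χ s x = ∏ μ, if s μ * x μ = 0 then (1 : ℝ) else -1 := ⟨_, fun _ _ => rfl⟩
  obtain ⟨lam, hlam⟩ : ∃ lam : TorusSite 4 2 → Matrix (Fin 3) (Fin 3) ℂ, ∀ x, lam x =
      ∑ s, ((χ s x / (32 * ∑ ν, if s ν = 0 then (0 : ℝ) else 1) : ℝ) : ℂ) •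
        ∑ μ : Fin 4, ∑ y, ((χ s y : ℝ) : ℂ) • Y (y, μ) := ⟨_, fun _ => rfl⟩
  refine ⟨lam, fun x => ?_, ?_⟩
  · simp only [hlam, Matrix.conjTranspose_sum, Matrix.conjTranspose_smul, Complex.star_def,
      Complex.conj_ofReal, hY, smul_neg, Finset.sum_neg_distrib]
  · refine GaugeCoercive.sum_frob_le_of_re_im _ _ (fun a b => ?_) (fun a b => ?_)
    · have key := GaugeCoercive.core χ hχ (fun e => (Y e a b).re)
        (fun x μ => by simp [hodd]) (fun x => (lam x a b).re) (fun x => by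
          simp only [hlam, Matrix.sum_apply, Matrix.smul_apply, smul_eq_mul, Complex.re_sum,
            Complex.re_ofReal_mul])
      simpa only [Matrix.sub_apply, Matrix.add_apply, Complex.sub_re, Complex.add_re] using key
    · have key := GaugeCoercive.core χ hχ (fun e => (Y e a b).im)
        (fun x μ => by simp [hodd]) (fun x => (lam x a b).im) (fun x => by
          simp only [hlam, Matrix.sum_apply, Matrix.smul_apply, smul_eq_mul, Complex.im_sum,
            Complex.im_ofReal_mul])
      simpa only [Matrix.sub_apply, Matrix.add_apply, Complex.sub_im, Complex.add_im] using key

end Summit.QuantumFields.QCD.Cruxes.CriticalLineDiamagnetism.ChessboardCellGain
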